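import Summits.QuantumFields.YangMills.Theorems.FluctuationComparisonRegPrIntLS2BetaChartReadCplxAnalytic
import Summits.QuantumFields.YangMills.Theorems.FluctuationComparisonRegPrIntLS2BetaChartReadDerivLocal
import HarnessLib

/-!
# S2β · (β-3) THE ORDER-2 ONE-STEP BRICK — [Balaban1985Averaging] PROPOSITION 3 (123) «|C(V₀, A, c)| ≤ C₁L²|A|²» FOR THE TREE's CHART-READ (0.4) EML AVERAGE, WITH A NUMERIC,
# VOLUME-INDEPENDENT CONSTANT, BY PRINT's ROAD: CAUCHY's ESTIMATE ON THE COMPLEX SUP-NORM POLYDISC OF (β-1)∕(β-2) (lit `B7TransferAnalyticMean.norm_sub_sub_fderiv_le_of_line`)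

Cell `ym3-torus` (YM ladder rung R3 = continuum `SU(2)` Yang–Mills on the three-torus at fixed lattice data — a RUNG: NOT d = 4, NOT infinite volume, NOT a mass gap,
NOT Clay).  Width seat `ym3-torus-px13` (gen 26); crux `stmt-QuantumFields-20520` (`…Theses.UnitScaleTilt.FluctuationComparisonRegPrIntL`), LINE g18-1 S2β, pairing lane
«CRIT-ax» ⟸ «MULT♭-ax» ⟸ `multAx_of_letters` ⟸ {Thm-1 pair, (RINV-curl)_q ✓p827199, AVG₂♭-ax_q}; AVG₂♭-ax_q's route (UV3-NODE §89.7 (px5 g22)) step (2) = THIS BRICK, consumed by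
Q7 (px5 g23: tower chain rule + second-order telescope) and the core (px10 g24).  `--kind proof --supports stmt-QuantumFields-20520 --as helper`, count-neutral, DEFINITION-FREE.

PRINT.  [Balaban1985Averaging] Prop. 3 p.36: «Q(V₀, A, c) = (1∕i) log(V̄₁)_c (121) … is an analytic function of A and … its Taylor expansion begins with a first-order polynomial …
Q(V₀, A, c) = L(Q(V₀)A)_c + C(V₀, A, c) (122) … |C(V₀, A, c)| ≦ C₁L²|A|² (123)».  THE ROAD (print's): analyticity on the polydisc `|A| < α₁` + a sup bound ⇒ (123) by Cauchy.
For the tree's one-step chart-read average `ψ_{U₀}(X)(c) = Λ(Ū(Θ^B(X)·U₀)(c)·Ū(U₀)(c)⁻¹)` (pub-ymgap N09 ∕ (D1) ✓p824693 conventions) the complexification `Φ_c` of (β-1)∕(β-2) is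
holomorphic on the sup-norm ball `‖A‖ < a` whenever `100·ℓ·(e^a − 1) ≤ ρ` with `‖Φ_c‖ ≤ 54ℓ(e^a − 1)` there, equals `↑ψ_{U₀}(·)(c)` on the real slice and has the same derivative at
`0`; lit ✓`B7TransferAnalyticMean.norm_sub_sub_fderiv_le_of_line` (second-order Cauchy estimate along the complex line through `X̂`) gives the brick.  NO second-order walk-sum
expansion is needed (px20 g22 LOCATE 15:18:14Z: the real road cannot extract the `t²`-coefficient from the lit first-order estimate; the complex road reads it by maximum modulus).

WHAT IS PROVED (sorry-free; `ℓ = (d+2)L`; hypotheses: `0 < ρ ≤ innerRadius (specialUnitaryLogChart (Fin N))` (`= 1∕3` for `N ≤ 9`), loop guard `dist1 (loopHol U₀ c i) ≤ α` at every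
coarse bond, `4α ≤ ρ`).
* §1 ★★★`norm_chartRead_sub_fderiv_le` (polydisc form): `0 < a`, `100ℓ(e^a − 1) ≤ ρ`, `4‖X‖ ≤ a` ⟹ `‖↑(ψ_{U₀}(X) c) − ↑((Dψ_{U₀}(0) X) c)‖ ≤ 8·(54ℓ(e^a − 1))·‖X‖²∕a²`;
  ★★★`norm_chartRead_sub_fderiv_le_of_norm_le` (**(123), numeric**: `‖X‖ ≤ ρ∕(800ℓ)` ⟹ **`≤ (172800∕ρ)·ℓ²·‖X‖²`**, i.e. `C₁ = 172800∕ρ`, volume-, background- and `L`-independent).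
* §2 ★★★`norm_chartRead_sub_fderiv_le_local`: the `X^{(c)}`-edition (`X` truncated to the bonds issuing from `B(c₋) ∪ B(c₊)`; (D1-loc) ✓`chartRead_apply_local`, ✓`fderiv_chartRead_apply_local`),
  `≤ (172800∕ρ)·ℓ²·‖X^{(c)}‖²` = `C₁ℓ²·(max_{b ∈ blocks(c)} ‖X_b‖)²` in the standing range `j + 1 ≤ m + K`.
* §4 ★★★`norm_chartRead_sub_fderiv_le_SU2`: the lane's edition — `SU(2)` (`ρ = innerRadius = 1∕3`, lit ✓`B10Eq18SigmaSU2Chart.innerRadius_su2`; inlined here), guard `α ≤ 1∕12`, `‖X‖ ≤ 1∕(2400ℓ)` ⟹ **`≤ 518400·ℓ²·‖X‖²`**.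
* §5 (no radius condition) `norm_coe_logChart_le_log_two` (`‖↑(Λ g)‖ ≤ log 2` ALWAYS), ★`norm_coe_fderiv_chartRead_le` (`‖↑((Dψ_{U₀}(0)X) c)‖ ≤ 216·ℓ·‖X‖`, Cauchy's first estimate),
  ★★★`norm_chartRead_sub_fderiv_le_global` (EVERY `X`: `≤ (448000∕ρ² + 172800∕ρ)·ℓ²·‖X‖²`), ★★★`norm_chartRead_sub_fderiv_le_global_SU2` (EVERY `X`: **`≤ 4550400·ℓ²·‖X‖²`**).
* §6 ★★★`norm_chartRead_sub_fderiv_le_local_global` ∕ ★★★`norm_chartRead_sub_fderiv_le_local_SU2`: the `X^{(c)}` editions with NO radius condition (EVERY `X`; SU(2): `≤ 4550400·ℓ²·‖X^{(c)}‖²`).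
* §3 ★★`norm_fderiv_cplxChartRead_sub_le`: `‖DΦ_c(A′)W − DΦ_c(0)W‖ ≤ 32·(54ℓ(e^a − 1))·‖W‖·‖A′‖∕a²` for complex chart moves `‖A′‖ ≤ a∕8` (lit ✓`norm_fderiv_sub_fderiv_le`) — the one-step shape
  of print's (148)–(149) «the functional derivative of the remainder is Lipschitz», for the core's use.

HONEST.  One printed proposition ((123)) for the tree's own `ψ`, by print's road over landed lit engines; the constant is crude (Lipschitz `12` of `eml`, triangle inequalities) but
NUMERIC; the PAIR-WEIGHT structure `w_c(b,b′)` of §89.4 is NOT here (sup-norm ∕ local-sup only), nor the k-step letter AVG₂♭-ax_q, Q6∕Q7, «MULT♭-ax»∕«CRIT-ax», (D-ax), GAP♯∘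
(registry UNTOUCHED), the five REGISTERED stubs, S2β, crux 20520, 19936, 19200, `YM3TorusSU2` — NOT proved; no summit statement is proved by a helper; rung R3 = SU(2) YM₃ on T³ at
fixed lattice data — NOT d = 4, NOT infinite volume, NOT a mass gap, NOT Clay; the Yang–Mills mass gap is NOT proved.  Axioms standard.

References: [Balaban1985Averaging] CMP **98** (1985) Prop. 3 (121)–(123) p.36, Prop. 4 (148)–(149) p.40; [Balaban1987RG1] CMP **109** (1987) (0.4), (0.8) p.253.
-/

set_option autoImplicit false

noncomputable section

open scoped Matrix.Norms.L2Operator Topology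
open Filter Set Function Metric

namespace Summit.QuantumFields.YangMills.Theorems.FluctuationComparisonRegPrIntLS2BetaChartReadSecondOrder

open Literature.MathematicalPhysics.QuantumFieldTheory.Balaban1983to89
open Literature.MathematicalPhysics.QuantumFieldTheory.Balaban1983to89.HaarExponentialChart
open Literature.MathematicalPhysics.QuantumFieldTheory.Balaban1983to89.HaarExponentialChart.IsChartRep
open Literature.MathematicalPhysics.QuantumFieldTheory.Balaban1983to89.BlockAveraging (Small Idx avgFun loopHol off corr)
open Literature.MathematicalPhysics.QuantumFieldTheory.Balaban1983to89.ExpMeanLog (eml expMeanLogSU deltaSU deltaSU_pos)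
open Literature.MathematicalPhysics.QuantumFieldTheory.Balaban1983to89.Node00
open Literature.MathematicalPhysics.QuantumFieldTheory.Balaban1983to89.T4Continuum (walk holAt LStep loopWord)
open MatrixLog (mlog)
open Literature.MathematicalPhysics.QuantumLattice (fundamentalRep fundamentalRep_apply)
open Summit.QuantumFields.YangMills.BalabanUVNodes.N09ChartReadAveragingSmooth
open Summit.QuantumFields.YangMills.Theorems.FluctuationComparisonRegPrIntLS2BetaChartReadCplxExtension
open Summit.QuantumFields.YangMills.Theorems.FluctuationComparisonRegPrIntLS2BetaChartReadCplxAnalytic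
open Summit.QuantumFields.YangMills.Theorems.FluctuationComparisonRegPrIntLS2BetaChartReadDerivLocal (chartRead_apply_local fderiv_chartRead_apply_local)

variable {P : Params} {j : ℕ} {N : ℕ} [NeZero N] (U₀ : GaugeField P j (SU N))

/-! ## §1 The brick on a polydisc of radius `a`: `‖↑(ψ_{U₀}(X) c) − ↑((Dψ_{U₀}(0) X) c)‖ ≤ 8·B(a)·‖X‖²∕a²`, `B(a) = 54·ℓ·(e^a − 1)` -/

section Brick

/-- On the ball `‖A‖ < a` the sup bound of (β-2) is uniform: `‖Φ_c(A)‖ ≤ 54·ℓ·(e^a − 1)`. [cite: Balaban1985Averaging, Prop. 3 (123) p.36 (bookkeeping)] -/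
theorem norm_cplxChartRead_le_of_mem_ball (c : PBond P (j + 1)) {α ρ : ℝ} (hρ : ρ ≤ innerRadius (specialUnitaryLogChart (Fin N)))
    (hα : ∀ i, dist1 (loopHol U₀ c i) ≤ α) (hα4 : 4 * α ≤ ρ) {a : ℝ} (ha : 100 * ((((P.d + 2) * P.L : ℕ) : ℝ) * (Real.exp a - 1)) ≤ ρ) :
    ∀ A ∈ ball (0 : PBond P j → Matrix (Fin N) (Fin N) ℂ) a, ‖mlog (eml (fun i : Idx P => ((walk (emb c.src) (loopWord P.L c.dir (off i.1) i.2.1 i.2.2)).map (fun s : LStep P j => if s.fwd then NormedSpace.exp (A s.bond) * ((U₀ s.bond : SU N) : Matrix (Fin N) (Fin N) ℂ) else star ((U₀ s.bond : SU N) : Matrix (Fin N) (Fin N) ℂ) * NormedSpace.exp (-(A s.bond)))).prod) * ((walk (emb c.src) (List.replicate P.L (c.dir, true))).map (fun s : LStep P j => if s.fwd then NormedSpace.exp (A s.bond) * ((U₀ s.bond : SU N) : Matrix (Fin N) (Fin N) ℂ) else star ((U₀ s.bond : SU N) : Matrix (Fin N) (Fin N) ℂ) * NormedSpace.exp (-(A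 s.bond)))).prod * star ((avgFun (expMeanLogSU (n := Fin N)) U₀ c : SU N) : Matrix (Fin N) (Fin N) ℂ))‖ ≤ 54 * ((((P.d + 2) * P.L : ℕ) : ℝ) * (Real.exp a - 1)) := by
  intro A hA
  have hAa : ‖A‖ ≤ a := (mem_ball_zero_iff.1 hA).le
  have hmono : Real.exp ‖A‖ - 1 ≤ Real.exp a - 1 := by linarith [Real.exp_le_exp.2 hAa]
  have hA' : 100 * ((((P.d + 2) * P.L : ℕ) : ℝ) * (Real.exp ‖A‖ - 1)) ≤ ρ := le_trans (by gcongr) ha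
  exact (norm_cplxChartRead_le U₀ c hρ hα hα4 A hA').trans (by gcongr)

/-- ★★★ **THE ORDER-2 ONE-STEP BRICK, POLYDISC FORM.**  For a background `U₀` in the loop `α`-guard at every coarse bond (`4α ≤ ρ ≤` the inner radius of the `SU(N)` log chart,
`0 < ρ`), a radius `a > 0` with `100·ℓ·(e^a − 1) ≤ ρ`, and a direction `X : PBond P j → 𝔰𝔲(N)` with `4‖X‖ ≤ a`:
  `‖↑(ψ_{U₀}(X) c) − ↑((Dψ_{U₀}(0) X) c)‖ ≤ 8·(54·ℓ·(e^a − 1))·‖X‖²∕a²`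
— Cauchy's second-order estimate along the complex line through `X̂` for the holomorphic, bounded `Φ_c` of (β-2), read on the real slice. [cite: Balaban1985Averaging, Prop. 3 (121)-(123) p.36] -/
theorem norm_chartRead_sub_fderiv_le {α ρ : ℝ} (hρ0 : 0 < ρ) (hρ : ρ ≤ innerRadius (specialUnitaryLogChart (Fin N)))
    (hα : ∀ c i, dist1 (loopHol U₀ c i) ≤ α) (hα4 : 4 * α ≤ ρ)
    {a : ℝ} (ha0 : 0 < a) (ha : 100 * ((((P.d + 2) * P.L : ℕ) : ℝ) * (Real.exp a - 1)) ≤ ρ) (X : PBond P j → (specialUnitaryLogChart (Fin N)).lie) (hX : 4 * ‖X‖ ≤ a) (c : PBond P (j + 1)) :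
    ‖(((isChartRep_specialUnitaryGroup (n := Fin N)).logChart (avgFun (expMeanLogSU (n := Fin N)) (fun b => (isChartRep_specialUnitaryGroup (n := Fin N)).expChart (X b) * U₀ b) c * (avgFun (expMeanLogSU (n := Fin N)) U₀ c)⁻¹) : (specialUnitaryLogChart (Fin N)).lie) : Matrix (Fin N) (Fin N) ℂ) - ((fderiv ℝ (fun (A : PBond P j → (specialUnitaryLogChart (Fin N)).lie) (c : PBond P (j + 1)) => (isChartRep_specialUnitaryGroup (n := Fin N)).logChart (avgFun (expMeanLogSU (n := Fin N)) (fun b => (isChartRep_specialUnitaryGroup (n := Fin N)).expChart (A b) * U₀ b) c * (avgFun (expMeanLogSU (n := Fin N)) U₀ c)⁻¹)) 0 X c : (specialUnitaryLogChart (Fin N)).lie) : Matrix (Fin N) (Fin N) ℂ)‖ ≤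
      8 * (54 * ((((P.d + 2) * P.L : ℕ) : ℝ) * (Real.exp a - 1))) * ‖X‖ ^ 2 / a ^ 2 := by
  have hαδ : α < deltaSU (Fin N) := by linarith [hρ.trans (innerRadius_le_deltaSU (N := N)), deltaSU_pos (n := Fin N)]
  have hsmall : Small (expMeanLogSU (n := Fin N)) U₀ c := fun i => lt_of_le_of_lt (hα c i) hαδ
  have hΦd := differentiableOn_cplxChartRead U₀ c hρ (hα c) hα4 ha
  have hB := norm_cplxChartRead_le_of_mem_ball U₀ c hρ (hα c) hα4 ha
  have hXh : ‖(fun b => ((X b : (specialUnitaryLogChart (Fin N)).lie) : Matrix (Fin N) (Fin N) ℂ))‖ ≤ ‖X‖ := norm_coePi_le X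
  have hu : (0 : PBond P j → Matrix (Fin N) (Fin N) ℂ) ∈ ball (0 : PBond P j → Matrix (Fin N) (Fin N) ℂ) a := mem_ball_self ha0
  have hv : 4 * ‖(fun b => ((X b : (specialUnitaryLogChart (Fin N)).lie) : Matrix (Fin N) (Fin N) ℂ))‖ ≤ a - ‖(0 : PBond P j → Matrix (Fin N) (Fin N) ℂ) - 0‖ := by
    rw [sub_self, norm_zero, sub_zero]; linarith
  have h := B7TransferAnalyticMean.norm_sub_sub_fderiv_le_of_line hΦd hB hu hv
  rw [zero_add, sub_self, norm_zero, sub_zero, cplxChartRead_zero U₀ c hsmall, sub_zero] at h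
  -- read on the real slice
  have hXa : ‖X‖ ≤ a := by linarith [norm_nonneg X]
  have hX' : 100 * ((((P.d + 2) * P.L : ℕ) : ℝ) * (Real.exp ‖X‖ - 1)) ≤ ρ := by
    have hmono : Real.exp ‖X‖ - 1 ≤ Real.exp a - 1 := by linarith [Real.exp_le_exp.2 hXa]
    exact le_trans (by gcongr) ha
  rw [← coe_chartRead_eq_cplxChartRead U₀ c hρ (hα c) hα4 hρ0 X hX', ← coe_fderiv_chartRead_apply_eq U₀ hρ hα hα4 hρ0 X c] at h
  have hB0 : 0 ≤ 54 * ((((P.d + 2) * P.L : ℕ) : ℝ) * (Real.exp a - 1)) := by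
    have : 0 ≤ Real.exp a - 1 := by linarith [Real.add_one_le_exp a]
    positivity
  calc _ ≤ 8 * (54 * ((((P.d + 2) * P.L : ℕ) : ℝ) * (Real.exp a - 1))) * ‖(fun b => ((X b : (specialUnitaryLogChart (Fin N)).lie) : Matrix (Fin N) (Fin N) ℂ))‖ ^ 2 / a ^ 2 := h
    _ ≤ 8 * (54 * ((((P.d + 2) * P.L : ℕ) : ℝ) * (Real.exp a - 1))) * ‖X‖ ^ 2 / a ^ 2 := by gcongr

/-- ★★★ **(123) FOR THE TREE's `ψ`, NUMERIC FORM** (`a := ρ∕(200ℓ)`): for `U₀` in the loop `α`-guard at every coarse bond (`4α ≤ ρ ≤` inner radius, `0 < ρ`) and every direction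
with `‖X‖ ≤ ρ∕(800·ℓ)`:  **`‖↑(ψ_{U₀}(X) c) − ↑((Dψ_{U₀}(0) X) c)‖ ≤ (172800∕ρ)·ℓ²·‖X‖²`**, `ℓ = (d+2)L` — print's `C₁L²|A|²` with `C₁` NUMERIC and independent of the volume,
of `L` beyond `ℓ²`, of `N` beyond `ρ`, and of the background (for `SU(2)`: `ρ = 1∕3`). [cite: Balaban1985Averaging, Prop. 3 (123) p.36] -/
theorem norm_chartRead_sub_fderiv_le_of_norm_le {α ρ : ℝ} (hρ0 : 0 < ρ) (hρ : ρ ≤ innerRadius (specialUnitaryLogChart (Fin N)))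
    (hα : ∀ c i, dist1 (loopHol U₀ c i) ≤ α) (hα4 : 4 * α ≤ ρ)
    (X : PBond P j → (specialUnitaryLogChart (Fin N)).lie) (hX : ‖X‖ ≤ ρ / (800 * (((P.d + 2) * P.L : ℕ) : ℝ))) (c : PBond P (j + 1)) :
    ‖(((isChartRep_specialUnitaryGroup (n := Fin N)).logChart (avgFun (expMeanLogSU (n := Fin N)) (fun b => (isChartRep_specialUnitaryGroup (n := Fin N)).expChart (X b) * U₀ b) c * (avgFun (expMeanLogSU (n := Fin N)) U₀ c)⁻¹) : (specialUnitaryLogChart (Fin N)).lie) : Matrix (Fin N) (Fin N) ℂ) - ((fderiv ℝ (fun (A : PBond P j → (specialUnitaryLogChart (Fin N)).lie) (c : PBond P (j + 1)) => (isChartRep_specialUnitaryGroup (n := Fin N)).logChart (avgFun (expMeanLogSU (n := Fin N)) (fun b => (isChartRep_specialUnitaryGroup (n := Fin N)).expChart (A b) * U₀ b) c * (avgFun (expMeanLogSU (n := Fin N)) U₀ c)⁻¹)) 0 X c : (specialUnitaryLogChart (Fin N)).lie) : Matrix (Fin N) (Fin N) ℂ)‖ ≤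
      172800 / ρ * (((P.d + 2) * P.L : ℕ) : ℝ) ^ 2 * ‖X‖ ^ 2 := by
  have hℓ1 : (1 : ℝ) ≤ (((P.d + 2) * P.L : ℕ) : ℝ) := by exact_mod_cast Nat.one_le_iff_ne_zero.2 (Nat.mul_ne_zero (by omega) P.L_pos.ne')
  have hρ3 : ρ ≤ 1 / 3 := hρ.trans innerRadius_le_third
  set a : ℝ := ρ / (200 * (((P.d + 2) * P.L : ℕ) : ℝ)) with ha
  have ha0 : 0 < a := by rw [ha]; positivity
  have ha1 : a ≤ 1 := by rw [ha, div_le_one (by positivity)]; linarith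
  have hea : Real.exp a - 1 ≤ 2 * a := by
    have h3 := Real.abs_exp_sub_one_sub_id_le (x := a) (by rw [abs_of_nonneg ha0.le]; exact ha1)
    have h4 : Real.exp a - 1 - a ≤ a ^ 2 := (le_abs_self _).trans h3
    nlinarith
  have hcond : 100 * ((((P.d + 2) * P.L : ℕ) : ℝ) * (Real.exp a - 1)) ≤ ρ := by
    calc 100 * ((((P.d + 2) * P.L : ℕ) : ℝ) * (Real.exp a - 1)) ≤ 100 * ((((P.d + 2) * P.L : ℕ) : ℝ) * (2 * a)) := by gcongr
      _ = ρ := by rw [ha]; field_simp; norm_num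
  have hX4 : 4 * ‖X‖ ≤ a := by
    rw [ha]; rw [le_div_iff₀ (by positivity)] at hX ⊢; linarith
  have h := norm_chartRead_sub_fderiv_le U₀ hρ0 hρ hα hα4 ha0 hcond X hX4 c
  have hX0 : 0 ≤ ‖X‖ := norm_nonneg X
  calc _ ≤ 8 * (54 * ((((P.d + 2) * P.L : ℕ) : ℝ) * (Real.exp a - 1))) * ‖X‖ ^ 2 / a ^ 2 := h
    _ ≤ 8 * (54 * ((((P.d + 2) * P.L : ℕ) : ℝ) * (2 * a))) * ‖X‖ ^ 2 / a ^ 2 := by gcongr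
    _ = 172800 / ρ * (((P.d + 2) * P.L : ℕ) : ℝ) ^ 2 * ‖X‖ ^ 2 := by rw [ha]; field_simp; ring

end Brick

/-! ## §2 The local edition: the brick reads `X` only on the bonds issuing from `B(c₋) ∪ B(c₊)` -/

section Local

/-- ★★★ **(123), LOCAL-SUP FORM**: with `X^{(c)}` the truncation of `X` to the bonds issuing from `B(c₋) ∪ B(c₊)` (both `ψ(X) c` and `(Dψ(0)X) c` read `X` only there, (D1-loc)
✓`chartRead_apply_local` ∕ ✓`fderiv_chartRead_apply_local`), in the standing range `j + 1 ≤ m + K`: if `‖X^{(c)}‖ ≤ ρ∕(800ℓ)` then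
`‖↑(ψ_{U₀}(X) c) − ↑((Dψ_{U₀}(0) X) c)‖ ≤ (172800∕ρ)·ℓ²·‖X^{(c)}‖²` — i.e. `≤ C₁ℓ²·(max_{b ∈ blocks(c)} ‖X_b‖)²`. [cite: Balaban1985Averaging, Prop. 3 (123) p.36, p.19] -/
theorem norm_chartRead_sub_fderiv_le_local (hj : j + 1 ≤ P.m + P.K) {α ρ : ℝ} (hρ0 : 0 < ρ) (hρ : ρ ≤ innerRadius (specialUnitaryLogChart (Fin N)))
    (hα : ∀ c i, dist1 (loopHol U₀ c i) ≤ α) (hα4 : 4 * α ≤ ρ)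
    (X : PBond P j → (specialUnitaryLogChart (Fin N)).lie) (c : PBond P (j + 1))
    (hX : ‖(fun b : PBond P j => if blockOf b.src = c.src ∨ blockOf b.src = c.tgt then X b else 0)‖ ≤ ρ / (800 * (((P.d + 2) * P.L : ℕ) : ℝ))) :
    ‖(((isChartRep_specialUnitaryGroup (n := Fin N)).logChart (avgFun (expMeanLogSU (n := Fin N)) (fun b => (isChartRep_specialUnitaryGroup (n := Fin N)).expChart (X b) * U₀ b) c * (avgFun (expMeanLogSU (n := Fin N)) U₀ c)⁻¹) : (specialUnitaryLogChart (Fin N)).lie) : Matrix (Fin N) (Fin N) ℂ) - ((fderiv ℝ (fun (A : PBond P j → (specialUnitaryLogChart (Fin N)).lie) (c : PBond P (j + 1)) => (isChartRep_specialUnitaryGroup (n := Fin N)).logChart (avgFun (expMeanLogSU (n := Fin N)) (fun b => (isChartRep_specialUnitaryGroup (n := Fin N)).expChart (A b) * U₀ b) c * (avgFun (expMeanLogSU (n := Fin N)) U₀ c)⁻¹)) 0 X c : (specialUnitaryLogChart (Fin N)).lie) : Matrix (Fin N) (Fin N) ℂ)‖ ≤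
      172800 / ρ * (((P.d + 2) * P.L : ℕ) : ℝ) ^ 2 * ‖(fun b : PBond P j => if blockOf b.src = c.src ∨ blockOf b.src = c.tgt then X b else 0)‖ ^ 2 := by
  classical
  have hαδ : α < deltaSU (Fin N) := by linarith [hρ.trans (innerRadius_le_deltaSU (N := N)), deltaSU_pos (n := Fin N)]
  have hsmall : ∀ c, Small (expMeanLogSU (n := Fin N)) U₀ c := fun c i => lt_of_le_of_lt (hα c i) hαδ
  have hagree : ∀ b : PBond P j, (blockOf b.src = c.src ∨ blockOf b.src = c.tgt) → X b = (fun b : PBond P j => if blockOf b.src = c.src ∨ blockOf b.src = c.tgt then X b else 0) b := fun b hb => by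
    simp only [hb, if_true]
  rw [chartRead_apply_local (P := P) (N := N) hj U₀ c hagree, fderiv_chartRead_apply_local (P := P) (N := N) hj U₀ hsmall c hagree]
  exact norm_chartRead_sub_fderiv_le_of_norm_le U₀ hρ0 hρ hα hα4 _ hX c

end Local

/-! ## §3 For free from the same polydisc: `DΦ_c` is Lipschitz along complex chart moves (the one-step shape of print's (148)–(149)) -/

section Lipschitz

/-- ★★ **THE DERIVATIVE OF THE COMPLEXIFIED CHART-READ AVERAGE IS LIPSCHITZ ON THE POLYDISC**: for `a > 0` with `100·ℓ·(e^a − 1) ≤ ρ`, every complex chart move `A′` with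
`‖A′‖ ≤ a∕8` and every complex direction `W`:  `‖DΦ_c(A′) W − DΦ_c(0) W‖ ≤ 32·(54·ℓ·(e^a − 1))·‖W‖·‖A′‖∕a²` (Cauchy for the holomorphic map `A ↦ DΦ_c(A) W`, lit
`B7TransferAnalyticMean.norm_fderiv_sub_fderiv_le`). [cite: Balaban1985Averaging, Prop. 4 (148)-(149) p.40] -/
theorem norm_fderiv_cplxChartRead_sub_le (c : PBond P (j + 1)) {α ρ : ℝ} (hρ : ρ ≤ innerRadius (specialUnitaryLogChart (Fin N)))
    (hα : ∀ i, dist1 (loopHol U₀ c i) ≤ α) (hα4 : 4 * α ≤ ρ) {a : ℝ} (ha0 : 0 < a) (ha : 100 * ((((P.d + 2) * P.L : ℕ) : ℝ) * (Real.exp a - 1)) ≤ ρ)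
    (A' : PBond P j → Matrix (Fin N) (Fin N) ℂ) (hA' : ‖A'‖ ≤ a / 8) (W : PBond P j → Matrix (Fin N) (Fin N) ℂ) :
    ‖fderiv ℂ (fun A : PBond P j → Matrix (Fin N) (Fin N) ℂ => mlog (eml (fun i : Idx P => ((walk (emb c.src) (loopWord P.L c.dir (off i.1) i.2.1 i.2.2)).map (fun s : LStep P j => if s.fwd then NormedSpace.exp (A s.bond) * ((U₀ s.bond : SU N) : Matrix (Fin N) (Fin N) ℂ) else star ((U₀ s.bond : SU N) : Matrix (Fin N) (Fin N) ℂ) * NormedSpace.exp (-(A s.bond)))).prod) * ((walk (emb c.src) (List.replicate P.L (c.dir, true))).map (fun s : LStep P j => if s.fwd then NormedSpace.exp (A s.bond) * ((U₀ s.bond : SU N) : Matrix (Fin N) (Fin N) ℂ) else star ((U₀ s.bond : SU N) : Matrix (Fin N) (Fin N) ℂ) * NormedSpace.exp (-(A s.bond)))).prod * star ((avgFun (expMeanLogSU (n := Fin N)) U₀ c : SU N) : Matrix (Fin N) (Fin N) ℂ))) A' W - fderiv ℂ (fun A : PBond P j → Matrix (Fin N) (Fin N) ℂ => mlog (eml (fun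 i : Idx P => ((walk (emb c.src) (loopWord P.L c.dir (off i.1) i.2.1 i.2.2)).map (fun s : LStep P j => if s.fwd then NormedSpace.exp (A s.bond) * ((U₀ s.bond : SU N) : Matrix (Fin N) (Fin N) ℂ) else star ((U₀ s.bond : SU N) : Matrix (Fin N) (Fin N) ℂ) * NormedSpace.exp (-(A s.bond)))).prod) * ((walk (emb c.src) (List.replicate P.L (c.dir, true))).map (fun s : LStep P j => if s.fwd then NormedSpace.exp (A s.bond) * ((U₀ s.bond : SU N) : Matrix (Fin N) (Fin N) ℂ) else star ((U₀ s.bond : SU N) : Matrix (Fin N) (Fin N) ℂ) * NormedSpace.exp (-(A s.bond)))).prod * star ((avgFun (expMeanLogSU (n := Fin N)) U₀ c : SU N) : Matrix (Fin N) (Fin N) ℂ))) 0 W‖ ≤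
      32 * (54 * ((((P.d + 2) * P.L : ℕ) : ℝ) * (Real.exp a - 1))) * ‖W‖ * ‖A'‖ / a ^ 2 := by
  have hB := norm_cplxChartRead_le_of_mem_ball U₀ c hρ hα hα4 ha
  have han := analyticOnNhd_cplxChartRead U₀ c hρ hα hα4 ha
  have hu : ‖A' - 0‖ ≤ a / 8 := by rw [sub_zero]; exact hA'
  have h := B7TransferAnalyticMean.norm_fderiv_sub_fderiv_le ha0 han hB hu W
  rw [sub_zero] at h
  exact h

end Lipschitz

/-! ## §4 The `SU(2)` edition (the lane's group): `ρ = 1∕3`, guard `α ≤ 1∕12`, `‖X‖ ≤ 1∕(2400ℓ)` ⟹ `≤ 518400·ℓ²·‖X‖²` -/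

section SU2

/-- ★★★ **(123) FOR THE TREE's `ψ` ON `SU(2)`**: for a background `U₀ : GaugeField P j SU(2)` in the loop guard `dist1 (loopHol U₀ c i) ≤ α ≤ 1∕12` at every coarse bond and every
direction with `‖X‖ ≤ 1∕(2400·ℓ)`:  **`‖↑(ψ_{U₀}(X) c) − ↑((Dψ_{U₀}(0) X) c)‖ ≤ 518400·ℓ²·‖X‖²`** (`ℓ = (d+2)L`). [cite: Balaban1985Averaging, Prop. 3 (123) p.36] -/
theorem norm_chartRead_sub_fderiv_le_SU2 (U₀ : GaugeField P j (SU 2)) {α : ℝ} (hα : ∀ c i, dist1 (loopHol U₀ c i) ≤ α) (hα12 : α ≤ 1 / 12)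
    (X : PBond P j → (specialUnitaryLogChart (Fin 2)).lie) (hX : ‖X‖ ≤ 1 / (2400 * (((P.d + 2) * P.L : ℕ) : ℝ))) (c : PBond P (j + 1)) :
    ‖(((isChartRep_specialUnitaryGroup (n := Fin 2)).logChart (avgFun (expMeanLogSU (n := Fin 2)) (fun b => (isChartRep_specialUnitaryGroup (n := Fin 2)).expChart (X b) * U₀ b) c * (avgFun (expMeanLogSU (n := Fin 2)) U₀ c)⁻¹) : (specialUnitaryLogChart (Fin 2)).lie) : Matrix (Fin 2) (Fin 2) ℂ) - ((fderiv ℝ (fun (A : PBond P j → (specialUnitaryLogChart (Fin 2)).lie) (c : PBond P (j + 1)) => (isChartRep_specialUnitaryGroup (n := Fin 2)).logChart (avgFun (expMeanLogSU (n := Fin 2)) (fun b => (isChartRep_specialUnitaryGroup (n := Fin 2)).expChart (A b) * U₀ b) c * (avgFun (expMeanLogSU (n := Fin 2)) U₀ c)⁻¹)) 0 X c : (specialUnitaryLogChart (Fin 2)).lie) : Matrix (Fin 2) (Fin 2) ℂ)‖ ≤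
      518400 * (((P.d + 2) * P.L : ℕ) : ℝ) ^ 2 * ‖X‖ ^ 2 := by
  have hρ : (1 / 3 : ℝ) ≤ innerRadius (specialUnitaryLogChart (Fin 2)) := by
    unfold innerRadius; rw [specialUnitaryLogChart_ρ, Fintype.card_fin]; norm_num
  have hX' : ‖X‖ ≤ (1 / 3) / (800 * (((P.d + 2) * P.L : ℕ) : ℝ)) := by rw [div_div]; convert hX using 2; ring
  have h := norm_chartRead_sub_fderiv_le_of_norm_le U₀ (by norm_num) hρ hα (by linarith) X hX' c
  calc _ ≤ 172800 / (1 / 3) * (((P.d + 2) * P.L : ℕ) : ℝ) ^ 2 * ‖X‖ ^ 2 := h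
    _ = 518400 * (((P.d + 2) * P.L : ℕ) : ℝ) ^ 2 * ‖X‖ ^ 2 := by norm_num

end SU2

/-! ## §5 The brick WITHOUT a radius condition: `‖Λ g‖ ≤ log 2` always and `‖Dψ(0)X‖ ≤ 216·ℓ·‖X‖` give `≤ C·ℓ²·‖X‖²` for EVERY `X` -/

section Global

/-- The log chart is a BOUNDED total map: `‖↑(Λ g)‖ ≤ log 2` for every `g` (`Λ g = log ↑g` when `‖↑g − 1‖ <` inner radius `≤ 1∕2`, where `‖log W‖ ≤ −log(1 − ‖W − 1‖) ≤ log 2`; `Λ g = 0` otherwise).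
[cite: Helgason2000, Ch. I §1 Thm. 1.14 (13) p. 96 (bookkeeping)] -/
theorem norm_coe_logChart_le_log_two (g : SU N) :
    ‖(((isChartRep_specialUnitaryGroup (n := Fin N)).logChart g : (specialUnitaryLogChart (Fin N)).lie) : Matrix (Fin N) (Fin N) ℂ)‖ ≤ Real.log 2 := by
  by_cases hg : ‖fundamentalRep (Fin N) g - 1‖ < innerRadius (specialUnitaryLogChart (Fin N))
  · rw [(isChartRep_specialUnitaryGroup (n := Fin N)).coe_logChart hg]
    have h1 : ‖fundamentalRep (Fin N) g - 1‖ < 1 := hg.trans_le (innerRadius_le_half.trans (by norm_num))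
    refine (MatrixLog.norm_mlog_le_neg_log h1).trans ?_
    have h2 : ‖fundamentalRep (Fin N) g - 1‖ ≤ 1 / 2 := (hg.trans_le innerRadius_le_half).le
    rw [← Real.log_inv]
    exact Real.log_le_log (inv_pos.2 (by linarith)) (by rw [inv_le_comm₀ (by linarith) (by norm_num)]; linarith)
  · unfold IsChartRep.logChart
    rw [dif_neg hg, Submodule.coe_zero, norm_zero]
    exact Real.log_nonneg (by norm_num)

/-- ★ **THE ONE-STEP DERIVATIVE IN SUP NORM FROM CAUCHY**: `‖↑((Dψ_{U₀}(0) X) c)‖ ≤ 216·ℓ·‖X‖` for EVERY direction `X` (Cauchy's first-derivative estimate for the bounded holomorphic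
`Φ_c` on the polydisc of radius `a = ρ∕(200ℓ)`, lit ✓`B7TransferAnalyticMean.norm_fderiv_apply_le_of_line`, read on the real slice; compare (D2)'s `(1+4(d+2))(1+c₃α)L‖X‖`).
[cite: Balaban1985Averaging, Prop. 3 (124)-(126) p.36] -/
theorem norm_coe_fderiv_chartRead_le {α ρ : ℝ} (hρ0 : 0 < ρ) (hρ : ρ ≤ innerRadius (specialUnitaryLogChart (Fin N)))
    (hα : ∀ c i, dist1 (loopHol U₀ c i) ≤ α) (hα4 : 4 * α ≤ ρ) (X : PBond P j → (specialUnitaryLogChart (Fin N)).lie) (c : PBond P (j + 1)) :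
    ‖((fderiv ℝ (fun (A : PBond P j → (specialUnitaryLogChart (Fin N)).lie) (c : PBond P (j + 1)) => (isChartRep_specialUnitaryGroup (n := Fin N)).logChart (avgFun (expMeanLogSU (n := Fin N)) (fun b => (isChartRep_specialUnitaryGroup (n := Fin N)).expChart (A b) * U₀ b) c * (avgFun (expMeanLogSU (n := Fin N)) U₀ c)⁻¹)) 0 X c : (specialUnitaryLogChart (Fin N)).lie) : Matrix (Fin N) (Fin N) ℂ)‖ ≤ 216 * (((P.d + 2) * P.L : ℕ) : ℝ) * ‖X‖ := by
  have hℓ1 : (1 : ℝ) ≤ (((P.d + 2) * P.L : ℕ) : ℝ) := by exact_mod_cast Nat.one_le_iff_ne_zero.2 (Nat.mul_ne_zero (by omega) P.L_pos.ne')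
  have hρ3 : ρ ≤ 1 / 3 := hρ.trans innerRadius_le_third
  set a : ℝ := ρ / (200 * (((P.d + 2) * P.L : ℕ) : ℝ)) with ha
  have ha0 : 0 < a := by rw [ha]; positivity
  have ha1 : a ≤ 1 := by rw [ha, div_le_one (by positivity)]; linarith
  have hea : Real.exp a - 1 ≤ 2 * a := by
    have h3 := Real.abs_exp_sub_one_sub_id_le (x := a) (by rw [abs_of_nonneg ha0.le]; exact ha1)
    have h4 : Real.exp a - 1 - a ≤ a ^ 2 := (le_abs_self _).trans h3
    nlinarith
  have hcond : 100 * ((((P.d + 2) * P.L : ℕ) : ℝ) * (Real.exp a - 1)) ≤ ρ := by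
    calc 100 * ((((P.d + 2) * P.L : ℕ) : ℝ) * (Real.exp a - 1)) ≤ 100 * ((((P.d + 2) * P.L : ℕ) : ℝ) * (2 * a)) := by gcongr
      _ = ρ := by rw [ha]; field_simp; norm_num
  have hΦd := differentiableOn_cplxChartRead U₀ c hρ (hα c) hα4 hcond
  have hB := norm_cplxChartRead_le_of_mem_ball U₀ c hρ (hα c) hα4 hcond
  have hu : (0 : PBond P j → Matrix (Fin N) (Fin N) ℂ) ∈ ball (0 : PBond P j → Matrix (Fin N) (Fin N) ℂ) a := mem_ball_self ha0
  have h := B7TransferAnalyticMean.norm_fderiv_apply_le_of_line hΦd hB hu (fun b => ((X b : (specialUnitaryLogChart (Fin N)).lie) : Matrix (Fin N) (Fin N) ℂ))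
  rw [sub_self, norm_zero, sub_zero, ← coe_fderiv_chartRead_apply_eq U₀ hρ hα hα4 hρ0 X c] at h
  have hXh : ‖(fun b => ((X b : (specialUnitaryLogChart (Fin N)).lie) : Matrix (Fin N) (Fin N) ℂ))‖ ≤ ‖X‖ := norm_coePi_le X
  have hB0 : 0 ≤ 54 * ((((P.d + 2) * P.L : ℕ) : ℝ) * (Real.exp a - 1)) := by
    have : 0 ≤ Real.exp a - 1 := by linarith [Real.add_one_le_exp a]
    positivity
  calc _ ≤ 2 * (54 * ((((P.d + 2) * P.L : ℕ) : ℝ) * (Real.exp a - 1))) * ‖(fun b => ((X b : (specialUnitaryLogChart (Fin N)).lie) : Matrix (Fin N) (Fin N) ℂ))‖ / a := h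
    _ ≤ 2 * (54 * ((((P.d + 2) * P.L : ℕ) : ℝ) * (2 * a))) * ‖X‖ / a := by gcongr
    _ = 216 * (((P.d + 2) * P.L : ℕ) : ℝ) * ‖X‖ := by field_simp; ring

/-- ★★★ **(123) FOR THE TREE's `ψ` WITH NO RADIUS CONDITION**: for `U₀` in the loop `α`-guard at every coarse bond (`4α ≤ ρ ≤` inner radius, `0 < ρ`) and EVERY direction `X`:
**`‖↑(ψ_{U₀}(X) c) − ↑((Dψ_{U₀}(0) X) c)‖ ≤ (448000∕ρ² + 172800∕ρ)·ℓ²·‖X‖²`** — inside the radius `ρ∕(800ℓ)` by §1, outside by `‖Λ‖ ≤ log 2 < 0.7` and `‖Dψ(0)X‖ ≤ 216ℓ‖X‖`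
(both `≤ const·‖X‖²∕r₀²` there). The consumer (AVG₂♭'s fibre mates are arbitrary) needs no case split. [cite: Balaban1985Averaging, Prop. 3 (123) p.36] -/
theorem norm_chartRead_sub_fderiv_le_global {α ρ : ℝ} (hρ0 : 0 < ρ) (hρ : ρ ≤ innerRadius (specialUnitaryLogChart (Fin N)))
    (hα : ∀ c i, dist1 (loopHol U₀ c i) ≤ α) (hα4 : 4 * α ≤ ρ) (X : PBond P j → (specialUnitaryLogChart (Fin N)).lie) (c : PBond P (j + 1)) :
    ‖(((isChartRep_specialUnitaryGroup (n := Fin N)).logChart (avgFun (expMeanLogSU (n := Fin N)) (fun b => (isChartRep_specialUnitaryGroup (n := Fin N)).expChart (X b) * U₀ b) c * (avgFun (expMeanLogSU (n := Fin N)) U₀ c)⁻¹) : (specialUnitaryLogChart (Fin N)).lie) : Matrix (Fin N) (Fin N) ℂ) - ((fderiv ℝ (fun (A : PBond P j → (specialUnitaryLogChart (Fin N)).lie) (c : PBond P (j + 1)) => (isChartRep_specialUnitaryGroup (n := Fin N)).logChart (avgFun (expMeanLogSU (n := Fin N)) (fun b => (isChartRep_specialUnitaryGroup (n := Fin N)).expChart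 (A b) * U₀ b) c * (avgFun (expMeanLogSU (n := Fin N)) U₀ c)⁻¹)) 0 X c : (specialUnitaryLogChart (Fin N)).lie) : Matrix (Fin N) (Fin N) ℂ)‖ ≤ (448000 / ρ ^ 2 + 172800 / ρ) * (((P.d + 2) * P.L : ℕ) : ℝ) ^ 2 * ‖X‖ ^ 2 := by
  have hℓ1 : (1 : ℝ) ≤ (((P.d + 2) * P.L : ℕ) : ℝ) := by exact_mod_cast Nat.one_le_iff_ne_zero.2 (Nat.mul_ne_zero (by omega) P.L_pos.ne')
  have hρ3 : ρ ≤ 1 / 3 := hρ.trans innerRadius_le_third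
  have hX0 : 0 ≤ ‖X‖ := norm_nonneg X
  by_cases hX : ‖X‖ ≤ ρ / (800 * (((P.d + 2) * P.L : ℕ) : ℝ))
  · have h := norm_chartRead_sub_fderiv_le_of_norm_le U₀ hρ0 hρ hα hα4 X hX c
    have hextra : 0 ≤ 448000 / ρ ^ 2 * (((P.d + 2) * P.L : ℕ) : ℝ) ^ 2 * ‖X‖ ^ 2 := by positivity
    nlinarith
  · rw [not_le] at hX
    set r₀ : ℝ := ρ / (800 * (((P.d + 2) * P.L : ℕ) : ℝ)) with hr₀
    have hr₀0 : 0 < r₀ := by rw [hr₀]; positivity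
    have h1 := norm_coe_logChart_le_log_two (N := N)
      (avgFun (expMeanLogSU (n := Fin N)) (fun b => (isChartRep_specialUnitaryGroup (n := Fin N)).expChart (X b) * U₀ b) c * (avgFun (expMeanLogSU (n := Fin N)) U₀ c)⁻¹)
    have h2 := norm_coe_fderiv_chartRead_le U₀ hρ0 hρ hα hα4 X c
    have hlog : Real.log 2 ≤ 0.7 := by
      have := Real.log_two_lt_d9; linarith
    -- `log 2 ≤ 0.7·(‖X‖∕r₀)²` and `216ℓ‖X‖ ≤ 216ℓ‖X‖²∕r₀`
    have hq : 1 ≤ ‖X‖ / r₀ := by rw [le_div_iff₀ hr₀0]; linarith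
    have hq2 : 1 ≤ (‖X‖ / r₀) ^ 2 := by nlinarith
    have hA : Real.log 2 ≤ 0.7 * (‖X‖ / r₀) ^ 2 := by nlinarith
    have hB : 216 * (((P.d + 2) * P.L : ℕ) : ℝ) * ‖X‖ ≤ 216 * (((P.d + 2) * P.L : ℕ) : ℝ) * ‖X‖ * (‖X‖ / r₀) := by
      have : 0 ≤ 216 * (((P.d + 2) * P.L : ℕ) : ℝ) * ‖X‖ := by positivity
      nlinarith
    have hsum : Real.log 2 + 216 * (((P.d + 2) * P.L : ℕ) : ℝ) * ‖X‖ ≤ (448000 / ρ ^ 2 + 172800 / ρ) * (((P.d + 2) * P.L : ℕ) : ℝ) ^ 2 * ‖X‖ ^ 2 := by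
      have e1 : 0.7 * (‖X‖ / r₀) ^ 2 = 448000 / ρ ^ 2 * (((P.d + 2) * P.L : ℕ) : ℝ) ^ 2 * ‖X‖ ^ 2 := by rw [hr₀]; field_simp; ring
      have e2 : 216 * (((P.d + 2) * P.L : ℕ) : ℝ) * ‖X‖ * (‖X‖ / r₀) = 172800 / ρ * (((P.d + 2) * P.L : ℕ) : ℝ) ^ 2 * ‖X‖ ^ 2 := by rw [hr₀]; field_simp; ring
      nlinarith
    exact ((norm_sub_le _ _).trans (add_le_add h1 h2)).trans hsum

/-- ★★★ **(123) ON `SU(2)` WITH NO RADIUS CONDITION**: guard `α ≤ 1∕12`, EVERY `X`: **`‖↑(ψ_{U₀}(X) c) − ↑((Dψ_{U₀}(0) X) c)‖ ≤ 4550400·ℓ²·‖X‖²`**. [cite: Balaban1985Averaging, Prop. 3 (123) p.36] -/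
theorem norm_chartRead_sub_fderiv_le_global_SU2 (U₀ : GaugeField P j (SU 2)) {α : ℝ} (hα : ∀ c i, dist1 (loopHol U₀ c i) ≤ α) (hα12 : α ≤ 1 / 12)
    (X : PBond P j → (specialUnitaryLogChart (Fin 2)).lie) (c : PBond P (j + 1)) :
    ‖(((isChartRep_specialUnitaryGroup (n := Fin 2)).logChart (avgFun (expMeanLogSU (n := Fin 2)) (fun b => (isChartRep_specialUnitaryGroup (n := Fin 2)).expChart (X b) * U₀ b) c * (avgFun (expMeanLogSU (n := Fin 2)) U₀ c)⁻¹) : (specialUnitaryLogChart (Fin 2)).lie) : Matrix (Fin 2) (Fin 2) ℂ) - ((fderiv ℝ (fun (A : PBond P j → (specialUnitaryLogChart (Fin 2)).lie) (c : PBond P (j + 1)) => (isChartRep_specialUnitaryGroup (n := Fin 2)).logChart (avgFun (expMeanLogSU (n := Fin 2)) (fun b => (isChartRep_specialUnitaryGroup (n := Fin 2)).expChart (A b) * U₀ b) c * (avgFun (expMeanLogSU (n := Fin 2)) U₀ c)⁻¹)) 0 X c : (specialUnitaryLogChart (Fin 2)).lie) : Matrix (Fin 2) (Fin 2) ℂ)‖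 ≤
      4550400 * (((P.d + 2) * P.L : ℕ) : ℝ) ^ 2 * ‖X‖ ^ 2 := by
  have hρ : (1 / 3 : ℝ) ≤ innerRadius (specialUnitaryLogChart (Fin 2)) := by
    unfold innerRadius; rw [specialUnitaryLogChart_ρ, Fintype.card_fin]; norm_num
  have h := norm_chartRead_sub_fderiv_le_global U₀ (by norm_num) hρ hα (by linarith) X c
  calc _ ≤ (448000 / (1 / 3) ^ 2 + 172800 / (1 / 3)) * (((P.d + 2) * P.L : ℕ) : ℝ) ^ 2 * ‖X‖ ^ 2 := h
    _ = 4550400 * (((P.d + 2) * P.L : ℕ) : ℝ) ^ 2 * ‖X‖ ^ 2 := by ring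

end Global

/-! ## §6 The local editions with no radius condition (the currency of the two-block `ℓ¹` count, px20 g23 (5a)) -/

section LocalGlobal

/-- ★★★ **(123), LOCAL-SUP FORM, NO RADIUS CONDITION**: in the standing range `j + 1 ≤ m + K`, for EVERY `X`:
`‖↑(ψ_{U₀}(X) c) − ↑((Dψ_{U₀}(0) X) c)‖ ≤ (448000∕ρ² + 172800∕ρ)·ℓ²·‖X^{(c)}‖²` (§5 at the truncation `X^{(c)}`, (D1-loc) locality). [cite: Balaban1985Averaging, Prop. 3 (123) p.36, p.19] -/
theorem norm_chartRead_sub_fderiv_le_local_global (hj : j + 1 ≤ P.m + P.K) {α ρ : ℝ} (hρ0 : 0 < ρ) (hρ : ρ ≤ innerRadius (specialUnitaryLogChart (Fin N)))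
    (hα : ∀ c i, dist1 (loopHol U₀ c i) ≤ α) (hα4 : 4 * α ≤ ρ)
    (X : PBond P j → (specialUnitaryLogChart (Fin N)).lie) (c : PBond P (j + 1)) :
    ‖(((isChartRep_specialUnitaryGroup (n := Fin N)).logChart (avgFun (expMeanLogSU (n := Fin N)) (fun b => (isChartRep_specialUnitaryGroup (n := Fin N)).expChart (X b) * U₀ b) c * (avgFun (expMeanLogSU (n := Fin N)) U₀ c)⁻¹) : (specialUnitaryLogChart (Fin N)).lie) : Matrix (Fin N) (Fin N) ℂ) - ((fderiv ℝ (fun (A : PBond P j → (specialUnitaryLogChart (Fin N)).lie) (c : PBond P (j + 1)) => (isChartRep_specialUnitaryGroup (n := Fin N)).logChart (avgFun (expMeanLogSU (n := Fin N)) (fun b => (isChartRep_specialUnitaryGroup (n := Fin N)).expChart (A b) * U₀ b) c * (avgFun (expMeanLogSU (n := Fin N)) U₀ c)⁻¹)) 0 X c : (specialUnitaryLogChart (Fin N)).lie) : Matrix (Fin N) (Fin N) ℂ)‖ ≤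
      (448000 / ρ ^ 2 + 172800 / ρ) * (((P.d + 2) * P.L : ℕ) : ℝ) ^ 2 * ‖(fun b : PBond P j => if blockOf b.src = c.src ∨ blockOf b.src = c.tgt then X b else 0)‖ ^ 2 := by
  classical
  have hαδ : α < deltaSU (Fin N) := by linarith [hρ.trans (innerRadius_le_deltaSU (N := N)), deltaSU_pos (n := Fin N)]
  have hsmall : ∀ c, Small (expMeanLogSU (n := Fin N)) U₀ c := fun c i => lt_of_le_of_lt (hα c i) hαδ
  have hagree : ∀ b : PBond P j, (blockOf b.src = c.src ∨ blockOf b.src = c.tgt) → X b = (fun b : PBond P j => if blockOf b.src = c.src ∨ blockOf b.src = c.tgt then X b else 0) b := fun b hb => by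
    simp only [hb, if_true]
  rw [chartRead_apply_local (P := P) (N := N) hj U₀ c hagree, fderiv_chartRead_apply_local (P := P) (N := N) hj U₀ hsmall c hagree]
  exact norm_chartRead_sub_fderiv_le_global U₀ hρ0 hρ hα hα4 _ c

/-- ★★★ **(123) ON `SU(2)`, LOCAL-SUP FORM, NO RADIUS CONDITION**: guard `α ≤ 1∕12`, `j + 1 ≤ m + K`, EVERY `X`: **`‖↑(ψ_{U₀}(X) c) − ↑((Dψ_{U₀}(0) X) c)‖ ≤ 4550400·ℓ²·‖X^{(c)}‖²`**
(so `Σ_c` of the left side is `≤ 4550400·2d·ℓ²·Σ_b ‖X b‖²` by the two-block count — px20 g23's (5a) file). [cite: Balaban1985Averaging, Prop. 3 (123) p.36, p.19] -/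
theorem norm_chartRead_sub_fderiv_le_local_SU2 (hj : j + 1 ≤ P.m + P.K) (U₀ : GaugeField P j (SU 2)) {α : ℝ} (hα : ∀ c i, dist1 (loopHol U₀ c i) ≤ α) (hα12 : α ≤ 1 / 12)
    (X : PBond P j → (specialUnitaryLogChart (Fin 2)).lie) (c : PBond P (j + 1)) :
    ‖(((isChartRep_specialUnitaryGroup (n := Fin 2)).logChart (avgFun (expMeanLogSU (n := Fin 2)) (fun b => (isChartRep_specialUnitaryGroup (n := Fin 2)).expChart (X b) * U₀ b) c * (avgFun (expMeanLogSU (n := Fin 2)) U₀ c)⁻¹) : (specialUnitaryLogChart (Fin 2)).lie) : Matrix (Fin 2) (Fin 2) ℂ) - ((fderiv ℝ (fun (A : PBond P j → (specialUnitaryLogChart (Fin 2)).lie) (c : PBond P (j + 1)) => (isChartRep_specialUnitaryGroup (n := Fin 2)).logChart (avgFun (expMeanLogSU (n := Fin 2)) (fun b => (isChartRep_specialUnitaryGroup (n := Fin 2)).expChart (A b) * U₀ b) c * (avgFun (expMeanLogSU (n := Fin 2)) U₀ c)⁻¹)) 0 X c : (specialUnitaryLogChart (Fin 2)).lie) : Matrix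 (Fin 2) (Fin 2) ℂ)‖ ≤
      4550400 * (((P.d + 2) * P.L : ℕ) : ℝ) ^ 2 * ‖(fun b : PBond P j => if blockOf b.src = c.src ∨ blockOf b.src = c.tgt then X b else 0)‖ ^ 2 := by
  have hρ : (1 / 3 : ℝ) ≤ innerRadius (specialUnitaryLogChart (Fin 2)) := by
    unfold innerRadius; rw [specialUnitaryLogChart_ρ, Fintype.card_fin]; norm_num
  have h := norm_chartRead_sub_fderiv_le_local_global U₀ hj (by norm_num) hρ hα (by linarith) X c
  have e : (448000 / (1 / 3) ^ 2 + 172800 / (1 / 3) : ℝ) = 4550400 := by norm_num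
  rw [e] at h
  exact h

end LocalGlobal

end Summit.QuantumFields.YangMills.Theorems.FluctuationComparisonRegPrIntLS2BetaChartReadSecondOrder

end
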